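import Summits.QuantumFields.YangMills.Theorems.F4SubCurvatureDoorTopChannelCoefficients
import Summits.QuantumFields.YangMills.Theorems.F4SubCurvatureDoorChannelExtraction
import Mathlib
import HarnessLib

/-!
# Route `F4SubCurvatureDoor`, crux ⟨stmt-QuantumFields-23125⟩ `RationalToGeneral`: LINE g18-A v5 — CSF build plan C2, ALL DEGREES AT ONCE:
# the CLEAN EXPANSION of a class kernel (independent `W(F₄)`-invariant harmonic basis, continuous coefficients with the UV budget, the IR
# bound and — under stub A — real-analyticity)

✓`F4SubCurvatureDoorTopChannelCoefficients.exists_topChannel_coefficients` rewrites ONE degree channel of an arbitrary finite harmonic channel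
expansion `K(x) = Σ_k g_k(‖x‖²) H_k(x)` (profiles `g_k` arbitrary, `H_k` possibly dependent) in an invariant independent basis with continuous,
budgeted coefficients.  This file does it for all degrees simultaneously and adds what the channelwise statement cannot see:

★ `exists_clean_expansion` — for `K : ℝ⁴ → ℝ` continuous off `0`, bounded outside the unit ball, with the budget `‖x‖⁸K → 0`, invariant under
the signed permutations and the `D₄`-preserving isometries, and any finite harmonic channel expansion: there are `B_j` (linearly independent,
harmonic, homogeneous of degrees `e_j`, each invariant at the level of evaluations under both families of isometries) and `β_j : ℝ → ℝ` with
  * `K(x) = Σ_j β_j(‖x‖) B_j(x)` for `x ≠ 0`, and channel by channel `Σ_{d_k = L} g_k(‖x‖²)H_k(x) = Σ_{e_j = L} β_j(‖x‖)B_j(x)`;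
  * `β_j` continuous on `(0,∞)`;  UV: `r^{e_j+8} β_j(r) → 0` (`r → 0⁺`);  IR: `|β_j(r)| r^{e_j} ≤ C` for `r ≥ 1` (from the bound outside the unit
    ball, via C2(iii) ✓`F4SubCurvatureDoorChannelExtraction.abs_channelCoeff_le` on the clean expansion — the integrability input (I) of
    `ChannelShellForm` at `M → 0`);
  * and, if `K` is real-analytic off the origin (stub A ✓`mirrorAnalyticity`), every `β_j` is real-analytic on `(0,∞)`
    (`β_j(r) r^{e_j} = Σ_i (M⁻¹)_{ji} K(rω_i)`, ✓`channelCoeff_eq_sum_pointValues`).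

THEOREMS ONLY; Mathlib + tree; no `sorry`; standard axioms.  HONEST LABEL: bookkeeping of an OPEN XL stub (`ChannelShellForm`); the analytic core
C3–C5, T1″ (the wall), ⟨23125⟩ / ⟨23035⟩, rung R2d and the summit remain OPEN; the Yang–Mills mass gap is NOT proved; no summit is proved by a
line.  Seat `ym-line-frs-p2` g14 (free hands), `--supports stmt-QuantumFields-23125`.
[cite: AxlerBourdonRamey2001, Thm. 5.7] [cite: Cheney1982, Ch. 3 Problem 23]
-/

set_option autoImplicit false

noncomputable section

namespace Summit.QuantumFields.YangMills.Theorems.F4SubCurvatureDoorCleanExpansion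

open MvPolynomial Filter
open scoped BigOperators Topology
open Literature.MathematicalPhysics.QuantumLattice (siteToE)
open Literature.LinearAlgebra (evalMatrix)
open Summit.QuantumFields.YangMills.Cruxes.OSLegsAtWeakCouplingC.Sketch (IsSignedPerm)
open Summit.QuantumFields.YangMills.Theorems.F4SubCurvatureDoorChannelSymmetry (exists_sphere_points_det_ne_zero)
open Summit.QuantumFields.YangMills.Theorems.F4SubCurvatureDoorChannelExtraction
  (channelCoeff_eq_sum_pointValues abs_channelCoeff_le)
open Summit.QuantumFields.YangMills.Theorems.F4SubCurvatureDoorTopChannelCoefficients (exists_topChannel_coefficients)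

/-- **Homogeneous blocks are independent**: a family of polynomials assembled from linearly independent blocks, the block `L`
consisting of homogeneous polynomials of degree `L`, is linearly independent. [cite: AxlerBourdonRamey2001, Thm. 5.7] -/
theorem linearIndependent_sigma_of_isHomogeneous {N : ℕ} {n : Fin (N + 1) → ℕ}
    (Ht : (L : Fin (N + 1)) → Fin (n L) → MvPolynomial (Fin 4) ℝ)
    (hhom : ∀ L a, (Ht L a).IsHomogeneous (L : ℕ)) (hli : ∀ L, LinearIndependent ℝ (Ht L)) :
    LinearIndependent ℝ (fun t : (Σ L : Fin (N + 1), Fin (n L)) => Ht t.1 t.2) := by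
  classical
  rw [Fintype.linearIndependent_iff]
  intro v hv t₀
  -- project the relation onto the homogeneous component of degree `t₀.1`
  have hproj := congrArg (homogeneousComponent (t₀.1 : ℕ)) hv
  rw [map_sum, map_zero, Fintype.sum_sigma] at hproj
  have hblock : ∀ L : Fin (N + 1), ∑ a : Fin (n L), homogeneousComponent (t₀.1 : ℕ) (v ⟨L, a⟩ • Ht L a)
      = if L = t₀.1 then ∑ a : Fin (n L), v ⟨L, a⟩ • Ht L a else 0 := by
    intro L
    by_cases hL : L = t₀.1
    · rw [if_pos hL]
      refine Finset.sum_congr rfl fun a _ => ?_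
      rw [map_smul, homogeneousComponent_of_mem ((mem_homogeneousSubmodule _ _).2 (hhom L a)), if_pos (by rw [hL])]
    · rw [if_neg hL]
      refine Finset.sum_eq_zero fun a _ => ?_
      rw [map_smul, homogeneousComponent_of_mem ((mem_homogeneousSubmodule _ _).2 (hhom L a)), if_neg, smul_zero]
      exact fun h => hL (Fin.ext h.symm)
  simp_rw [hblock] at hproj
  rw [Finset.sum_ite_eq' Finset.univ t₀.1, if_pos (Finset.mem_univ _)] at hproj
  exact Fintype.linearIndependent_iff.mp (hli t₀.1) (fun a => v ⟨t₀.1, a⟩) hproj t₀.2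

/-- ★ **THE CLEAN EXPANSION (CSF build plan C2, all degrees).**  See the module docstring. [cite: AxlerBourdonRamey2001, Thm. 5.7]
[cite: Cheney1982, Ch. 3 Problem 23] -/
theorem exists_clean_expansion {ι : Type*} [Fintype ι] (K : EuclideanSpace ℝ (Fin 4) → ℝ)
    (hcont : ContinuousOn K {x | x ≠ 0}) (hbd : ∃ C : ℝ, ∀ x, 1 ≤ ‖x‖ → |K x| ≤ C)
    (hbud : Tendsto (fun x : EuclideanSpace ℝ (Fin 4) => ‖x‖ ^ 8 * K x) (𝓝[≠] 0) (𝓝 0))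
    (hB : ∀ R : EuclideanSpace ℝ (Fin 4) ≃ₗᵢ[ℝ] EuclideanSpace ℝ (Fin 4), IsSignedPerm R → ∀ x, K (R x) = K x)
    (hlat : ∀ R : EuclideanSpace ℝ (Fin 4) ≃ₗᵢ[ℝ] EuclideanSpace ℝ (Fin 4),
      (∀ z : Fin 4 → ℤ, Even (∑ i, z i) → ∃ w : Fin 4 → ℤ, Even (∑ i, w i) ∧ R (siteToE z) = siteToE w) →
      ∀ x, K (R x) = K x)
    (H : ι → MvPolynomial (Fin 4) ℝ) (d : ι → ℕ) (g : ι → ℝ → ℝ)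
    (hH : ∀ k, (H k).IsHomogeneous (d k)) (hharm : ∀ k, ∑ i, pderiv i (pderiv i (H k)) = 0)
    (hexp : ∀ x : EuclideanSpace ℝ (Fin 4), x ≠ 0 → K x = ∑ k, g k (‖x‖ ^ 2) * eval (fun i => x i) (H k)) :
    ∃ (m : ℕ) (B : Fin m → MvPolynomial (Fin 4) ℝ) (e : Fin m → ℕ) (β : Fin m → ℝ → ℝ),
      (∀ j, (B j).IsHomogeneous (e j)) ∧ (∀ j, ∑ i, pderiv i (pderiv i (B j)) = 0) ∧ LinearIndependent ℝ B ∧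
      (∀ j (R : EuclideanSpace ℝ (Fin 4) ≃ₗᵢ[ℝ] EuclideanSpace ℝ (Fin 4)), IsSignedPerm R →
        ∀ y : EuclideanSpace ℝ (Fin 4), eval (fun i => (R y) i) (B j) = eval (fun i => y i) (B j)) ∧
      (∀ j (R : EuclideanSpace ℝ (Fin 4) ≃ₗᵢ[ℝ] EuclideanSpace ℝ (Fin 4)),
        (∀ z : Fin 4 → ℤ, Even (∑ i, z i) → ∃ w : Fin 4 → ℤ, Even (∑ i, w i) ∧ R (siteToE z) = siteToE w) →
        ∀ y : EuclideanSpace ℝ (Fin 4), eval (fun i => (R y) i) (B j) = eval (fun i => y i) (B j)) ∧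
      (∀ j, ContinuousOn (β j) (Set.Ioi 0)) ∧
      (∀ j, Tendsto (fun r : ℝ => r ^ (e j + 8) * β j r) (𝓝[>] 0) (𝓝 0)) ∧
      (∃ C : ℝ, ∀ j (r : ℝ), 1 ≤ r → |β j r| * r ^ (e j) ≤ C) ∧
      ((∀ x : EuclideanSpace ℝ (Fin 4), x ≠ 0 → AnalyticAt ℝ K x) → ∀ j, AnalyticOnNhd ℝ (β j) (Set.Ioi 0)) ∧
      (∀ x : EuclideanSpace ℝ (Fin 4), x ≠ 0 → K x = ∑ j, β j ‖x‖ * eval (fun i => x i) (B j)) ∧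
      (∀ (L : ℕ) (x : EuclideanSpace ℝ (Fin 4)), x ≠ 0 →
        ∑ k ∈ Finset.univ.filter (fun k => d k = L), g k (‖x‖ ^ 2) * eval (fun i => x i) (H k)
          = ∑ j ∈ Finset.univ.filter (fun j => e j = L), β j ‖x‖ * eval (fun i => x i) (B j)) := by
  classical
  /- 1. Channelwise data from C2. -/
  choose n Ht c hhom hharm' hli hsymB hsymL hcont' hbud' hrep using
    fun L : ℕ => exists_topChannel_coefficients K hcont hbud hB hlat H d g hH hharm hexp L
  set N : ℕ := Finset.univ.sup d with hN
  have hdeg : ∀ k, d k ≤ N := fun k => Finset.le_sup (f := d) (Finset.mem_univ k)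
  /- 2. The combined family, indexed by `Σ L : Fin (N+1), Fin (n L)` and then by `Fin m`. -/
  let T := Σ L : Fin (N + 1), Fin (n L)
  let BT : T → MvPolynomial (Fin 4) ℝ := fun t => Ht t.1 t.2
  let eTn : T → ℕ := fun t => (t.1 : ℕ)
  let βT : T → ℝ → ℝ := fun t => c t.1 t.2
  have hliT : LinearIndependent ℝ BT :=
    linearIndependent_sigma_of_isHomogeneous (n := fun L : Fin (N + 1) => n L) (fun L a => Ht L a)
      (fun L a => hhom L a) (fun L => hli L)
  -- the full expansion over `T`
  have hKT : ∀ x : EuclideanSpace ℝ (Fin 4), x ≠ 0 → K x = ∑ t : T, βT t ‖x‖ * eval (fun i => x i) (BT t) := by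
    intro x hx
    rw [hexp x hx, Fintype.sum_sigma]
    rw [← Finset.sum_fiberwise_of_maps_to (s := Finset.univ) (t := Finset.range (N + 1)) (g := d)
      (fun k _ => Finset.mem_range.2 (Nat.lt_succ_of_le (hdeg k)))]
    rw [Finset.sum_range (fun L => ∑ k ∈ Finset.univ.filter (fun k => d k = L),
      g k (‖x‖ ^ 2) * eval (fun i => x i) (H k))]
    exact Finset.sum_congr rfl fun L _ => hrep L x hx
  -- channel by channel over `T`
  have hchanT : ∀ (L : ℕ) (x : EuclideanSpace ℝ (Fin 4)), x ≠ 0 →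
      ∑ k ∈ Finset.univ.filter (fun k => d k = L), g k (‖x‖ ^ 2) * eval (fun i => x i) (H k)
        = ∑ t ∈ Finset.univ.filter (fun t : T => eTn t = L), βT t ‖x‖ * eval (fun i => x i) (BT t) := by
    intro L x hx
    by_cases hL : L ≤ N
    · -- the fibre over `L` is the block `⟨L, ·⟩`
      let L' : Fin (N + 1) := ⟨L, Nat.lt_succ_of_le hL⟩
      have hfib : Finset.univ.filter (fun t : T => eTn t = L)
          = (Finset.univ : Finset (Fin (n L'))).map
              ⟨fun a => (⟨L', a⟩ : T), fun a b h => eq_of_heq (Sigma.mk.inj_iff.mp h).2⟩ := by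
        ext ⟨M, a⟩
        simp only [Finset.mem_filter, Finset.mem_univ, true_and, Finset.mem_map, Function.Embedding.coeFn_mk, eTn]
        constructor
        · intro h
          have hM : M = L' := Fin.ext h
          subst hM
          exact ⟨a, rfl⟩
        · rintro ⟨b, hb⟩
          rw [Sigma.mk.inj_iff] at hb
          obtain ⟨hb1, _⟩ := hb
          rw [← hb1]
      rw [hfib, Finset.sum_map]
      exact hrep L x hx
    · -- no channel of degree `L > N` on either side
      rw [not_le] at hL
      have h1 : Finset.univ.filter (fun k => d k = L) = ∅ := by
        refine Finset.filter_eq_empty_iff.2 fun k _ h => ?_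
        have := hdeg k; omega
      have h2 : Finset.univ.filter (fun t : T => eTn t = L) = ∅ := by
        refine Finset.filter_eq_empty_iff.2 fun t _ h => ?_
        have := t.1.isLt; simp only [eTn] at h; omega
      rw [h1, h2, Finset.sum_empty, Finset.sum_empty]
  /- 3. Reindex by `Fin m`. -/
  let eT := Fintype.equivFin T
  set m : ℕ := Fintype.card T
  let B : Fin m → MvPolynomial (Fin 4) ℝ := fun j => BT (eT.symm j)
  let e : Fin m → ℕ := fun j => eTn (eT.symm j)
  let β : Fin m → ℝ → ℝ := fun j => βT (eT.symm j)
  have hBhom : ∀ j, (B j).IsHomogeneous (e j) := fun j => hhom _ _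
  have hBharm : ∀ j, ∑ i, pderiv i (pderiv i (B j)) = 0 := fun j => hharm' _ _
  have hBli : LinearIndependent ℝ B := hliT.comp eT.symm eT.symm.injective
  have hK : ∀ x : EuclideanSpace ℝ (Fin 4), x ≠ 0 → K x = ∑ j, β j ‖x‖ * eval (fun i => x i) (B j) := by
    intro x hx
    rw [hKT x hx]
    exact Fintype.sum_equiv eT _ _ fun t => by simp only [B, β, Equiv.symm_apply_apply]
  have hchan : ∀ (L : ℕ) (x : EuclideanSpace ℝ (Fin 4)), x ≠ 0 →
      ∑ k ∈ Finset.univ.filter (fun k => d k = L), g k (‖x‖ ^ 2) * eval (fun i => x i) (H k)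
        = ∑ j ∈ Finset.univ.filter (fun j => e j = L), β j ‖x‖ * eval (fun i => x i) (B j) := by
    intro L x hx
    rw [hchanT L x hx]
    exact Finset.sum_equiv eT (fun t => by simp [e, Equiv.symm_apply_apply]) (fun t _ => by
      simp only [B, β, Equiv.symm_apply_apply])
  /- 4. Unisolvent points for the clean basis: the IR bound and analyticity. -/
  obtain ⟨ω, hω⟩ := exists_sphere_points_det_ne_zero B hBharm hBli
  have hω' : (evalMatrix (fun j (w : Metric.sphere (0 : EuclideanSpace ℝ (Fin 4)) 1) =>
      eval (fun i => (w : EuclideanSpace ℝ (Fin 4)) i) (B j)) ω).det ≠ 0 := hω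
  have hω1 : ∀ i, ‖(ω i : EuclideanSpace ℝ (Fin 4))‖ = 1 := fun i => by simp
  have hωne : ∀ i (r : ℝ), 0 < r → r • (ω i : EuclideanSpace ℝ (Fin 4)) ≠ 0 := by
    intro i r hr h0
    have := congrArg (fun v : EuclideanSpace ℝ (Fin 4) => ‖v‖) h0
    simp only [norm_smul, Real.norm_eq_abs, hω1, mul_one, norm_zero] at this
    exact hr.ne' (abs_eq_zero.1 this)
  obtain ⟨CK, hCK⟩ := hbd
  -- IR bound
  have hIR : ∃ C : ℝ, ∀ j (r : ℝ), 1 ≤ r → |β j r| * r ^ (e j) ≤ C := by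
    refine ⟨(∑ j, ∑ i, |(evalMatrix (fun j (w : Metric.sphere (0 : EuclideanSpace ℝ (Fin 4)) 1) =>
        eval (fun l => (w : EuclideanSpace ℝ (Fin 4)) l) (B j)) ω)⁻¹ j i|) * |CK|, fun j r hr => ?_⟩
    have hr0 : 0 < r := lt_of_lt_of_le one_pos hr
    have hg : ∀ i, |K (r • (ω i : EuclideanSpace ℝ (Fin 4)))| ≤ |CK| := by
      intro i
      refine (hCK _ ?_).trans (le_abs_self CK)
      rw [norm_smul, Real.norm_eq_abs, abs_of_pos hr0, hω1, mul_one]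
      exact hr
    refine (abs_channelCoeff_le B e hBhom K β hK ω hω' hr0 hg j).trans ?_
    refine mul_le_mul_of_nonneg_right ?_ (abs_nonneg _)
    exact Finset.single_le_sum (f := fun j => ∑ i, |(evalMatrix (fun j (w : Metric.sphere (0 : EuclideanSpace ℝ (Fin 4)) 1) =>
        eval (fun l => (w : EuclideanSpace ℝ (Fin 4)) l) (B j)) ω)⁻¹ j i|)
      (fun j _ => Finset.sum_nonneg fun i _ => abs_nonneg _) (Finset.mem_univ j)
  -- analyticity on `(0,∞)` under stub A
  have hAn : (∀ x : EuclideanSpace ℝ (Fin 4), x ≠ 0 → AnalyticAt ℝ K x) → ∀ j, AnalyticOnNhd ℝ (β j) (Set.Ioi 0) := by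
    intro hAK j r₀ hr₀
    have hr₀' : (0 : ℝ) < r₀ := hr₀
    -- the point-value formula, divided by `r^{e_j}`
    let F : ℝ → ℝ := fun r => (r ^ (e j))⁻¹ *
      ∑ i, (evalMatrix (fun j (w : Metric.sphere (0 : EuclideanSpace ℝ (Fin 4)) 1) =>
          eval (fun l => (w : EuclideanSpace ℝ (Fin 4)) l) (B j)) ω)⁻¹ j i * K (r • (ω i : EuclideanSpace ℝ (Fin 4)))
    have hF : AnalyticAt ℝ F r₀ := by
      refine ((analyticAt_id.pow (e j)).inv (pow_ne_zero _ hr₀'.ne')).mul ?_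
      refine Finset.univ.analyticAt_fun_sum fun i _ => analyticAt_const.mul ?_
      exact (hAK _ (hωne i r₀ hr₀')).comp_of_eq (analyticAt_id.smul analyticAt_const) rfl
    refine hF.congr ?_
    filter_upwards [Ioi_mem_nhds hr₀'] with r hr
    have hrpos : (0 : ℝ) < r := hr
    have h := channelCoeff_eq_sum_pointValues B e hBhom K β hK ω hω' hrpos j
    have hre : r ^ (e j) ≠ 0 := pow_ne_zero _ hrpos.ne'
    simp only [F]
    rw [← h, mul_comm (β j r), ← mul_assoc, inv_mul_cancel₀ hre, one_mul]
  /- 5. Assemble. -/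
  exact ⟨m, B, e, β, hBhom, hBharm, hBli, fun j R hR => hsymB _ _ R hR, fun j R hR => hsymL _ _ R hR,
    fun j => hcont' _ _, fun j => hbud' _ _, hIR, hAn, hK, hchan⟩

end Summit.QuantumFields.YangMills.Theorems.F4SubCurvatureDoorCleanExpansion

end
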